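import Literature.NumberTheory.CubicFields.HessianReduction
import Literature.NumberTheory.CubicFields.DeloneFaddeevIrreducible
import Mathlib.NumberTheory.Modular
import Literature.Algebra.Polynomial.RealCubicRoots
import HarnessLib

/-!
# Reduction of integral binary cubic forms of negative discriminant (Mathews / Davenport 1951 II)

`Proofs` file (theorems only), topic `Literature/NumberTheory/CubicFields`, the negative-discriminant
counterpart of `HessianReduction.lean`.  A real binary cubic form `f` with `a ≠ 0` and `Disc f < 0` has one
real root `θ` and a pair of complex conjugate roots `β, β̄` (`roots_of_disc_neg`); following Mathews
(1891), Berwick–Mathews and Davenport (*On the class-number of binary cubic forms II*, J. London Math.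
Soc. 26 (1951)), `f` is called REDUCED when the positive definite quadratic `(x − βy)(x − β̄y)` is
reduced, i.e. when `β` lies in the standard fundamental domain `𝒟` of `SL₂(ℤ)` on `ℍ`
(`|Re β| ≤ ½`, `|β| ≥ 1`).  We prove:

* `roots_of_disc_neg`, `exists_complexRoot` — the root structure `{θ, β, β̄}` and the coefficient
  relations `b = −a(θ + 2 Re β)`, `c = a(2θ Re β + |β|²)`, `d = −aθ|β|²`, with `β` the UNIQUE root in `ℍ`;
* `exists_gl2zEquiv_negReduced` — **every irreducible integral form of negative discriminant is
  `GL₂(ℤ)`-equivalent to a reduced one**, stated with the real witnesses `(θ, u, v) = (θ, Re β, Im β)`: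
  `|u| ≤ ½`, `1 ≤ u² + v²`, `0 < v`, and the three coefficient relations (root covariance
  `β(f ∘ γ) = (γᵀ)⁻¹ • β(f)` + Mathlib's `ModularGroup.exists_smul_mem_fd`).

## References

* H. Davenport, *On the class-number of binary cubic forms II*, J. London Math. Soc. 26 (1951)
  192–198, §2 [Davenport1951CubicFormsII].
* J. E. Cremona, *Reduction of binary cubic and quartic forms*, LMS J. Comput. Math. 2 (1999) 62–92,
  §3.3 (the same reduction via the covariant quadratic `(x − β)(x − β̄)`; background only).
-/

noncomputable section

open scoped MatrixGroups ComplexConjugate UpperHalfPlane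

namespace Literature.NumberTheory.CubicFields

namespace BinaryCubic

open Complex Polynomial

/-! ### Roots of a real cubic form of negative discriminant -/

/-- Homogeneity: `f(tu, tv) = t³ f(u, v)`. [folklore] -/
theorem eval_mul_mul {R : Type*} [CommRing R] (f : BinaryCubic R) (t u v : R) :
    f.eval (t * u) (t * v) = t ^ 3 * f.eval u v := by
  simp only [eval]; ring

/-- `x` is a root of `f(·, 1)` over `ℂ` iff it lies in the root multiset of `toCubic`. [folklore] -/
theorem eval_eq_zero_iff_mem_roots (F : BinaryCubic ℝ) (ha : F.a ≠ 0) (x : ℂ) :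
    (F.map ofRealHom).eval x 1 = 0 ↔ x ∈ (F.toCubic.map ofRealHom).roots := by
  have h0 : (F.toCubic.map ofRealHom).toPoly ≠ 0 :=
    Cubic.ne_zero_of_a_ne_zero (by simp [Cubic.map, toCubic, ha])
  rw [Cubic.mem_roots_iff h0, eval]
  simp [Cubic.map, toCubic]

/-- **The roots of a real cubic form with `a ≠ 0` and `Disc < 0`**: one real root `θ` and a pair of
complex conjugate roots `β, β̄` with `Im β > 0` (root pattern from
`Literature.Algebra.Polynomial.roots_real_or_conj_pair`). [folklore] -/
theorem roots_of_disc_neg (F : BinaryCubic ℝ) (ha : F.a ≠ 0) (hD : F.disc < 0) :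
    ∃ θ : ℝ, ∃ β : ℂ, 0 < β.im ∧ (F.toCubic.map ofRealHom).roots = {(θ : ℂ), β, conj β} := by
  have ha' : F.toCubic.a ≠ 0 := by simpa using ha
  obtain ⟨x, y, z, h3⟩ := (Cubic.splits_iff_roots_eq_three ha').mp
    (IsAlgClosed.splits (F.toCubic.toPoly.map ofRealHom))
  have hdisc : F.toCubic.discr ≠ 0 := by
    have : F.disc = F.toCubic.discr := rfl
    rw [← this]; exact hD.ne
  obtain ⟨hxy, hxz, hyz⟩ := (Cubic.discr_ne_zero_iff_roots_ne ha' h3).mp hdisc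
  rcases Literature.Algebra.Polynomial.roots_real_or_conj_pair ha' h3 hxy hxz hyz with
    ⟨hx, hy, hz⟩ | ⟨t, u, ht, hu, h3'⟩
  · have hpos := Literature.Algebra.Polynomial.discr_pos_of_roots_real ha' h3 hxy hxz hyz hx hy hz
    have : F.disc = F.toCubic.discr := rfl
    rw [← this] at hpos
    exact absurd hD (not_lt.mpr hpos.le)
  · have ht' : ((t.re : ℝ) : ℂ) = t := Complex.conj_eq_iff_re.mp ht
    have hune : u.im ≠ 0 := fun h => hu (Complex.conj_eq_iff_im.mpr h)
    rcases lt_or_gt_of_ne hune with hneg | hpos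
    · refine ⟨t.re, conj u, ?_, ?_⟩
      · rw [Complex.conj_im]; linarith
      · rw [h3', Complex.conj_conj, ht']
        -- `{t, u, ū} = {t, ū, u}`
        exact ((Literature.Algebra.Polynomial.multiset_triple_swap t u (conj u)).trans
          (Literature.Algebra.Polynomial.multiset_triple_rotate u t (conj u))).trans
          (Literature.Algebra.Polynomial.multiset_triple_rotate (conj u) u t)
    · exact ⟨t.re, u, hpos, by rw [h3', ht']⟩

/-- **The complex root of a real cubic form of negative discriminant** (`a ≠ 0`): there are a real `θ`
and `β ∈ ℍ` with `b = −a(θ + 2 Re β)`, `c = a(2θ Re β + |β|²)`, `d = −aθ|β|²` (i.e.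
`f(x, 1) = a(x − θ)(x − β)(x − β̄)`), and `β` is the unique root of `f(·, 1)` in `ℍ`. [folklore] -/
theorem exists_complexRoot (F : BinaryCubic ℝ) (ha : F.a ≠ 0) (hD : F.disc < 0) :
    ∃ θ : ℝ, ∃ β : ℂ, 0 < β.im ∧ F.b = -F.a * (θ + 2 * β.re) ∧
      F.c = F.a * (2 * θ * β.re + Complex.normSq β) ∧ F.d = -F.a * (θ * Complex.normSq β) ∧
      (F.map ofRealHom).eval β 1 = 0 ∧
      ∀ w : ℂ, 0 < w.im → (F.map ofRealHom).eval w 1 = 0 → w = β := by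
  have ha' : F.toCubic.a ≠ 0 := by simpa using ha
  obtain ⟨θ, β, hβ, h3⟩ := roots_of_disc_neg F ha hD
  refine ⟨θ, β, hβ, ?_, ?_, ?_, ?_, ?_⟩
  · have h := congrArg Complex.re (Cubic.b_eq_three_roots (φ := ofRealHom) ha' h3)
    simp [toCubic] at h
    linear_combination h
  · have h := congrArg Complex.re (Cubic.c_eq_three_roots (φ := ofRealHom) ha' h3)
    simp [toCubic, Complex.mul_re] at h
    rw [Complex.normSq_apply]
    linear_combination h
  · have h := congrArg Complex.re (Cubic.d_eq_three_roots (φ := ofRealHom) ha' h3)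
    simp [toCubic, Complex.mul_re, Complex.mul_im] at h
    rw [Complex.normSq_apply]
    linear_combination h
  · rw [eval_eq_zero_iff_mem_roots F ha, h3]; simp
  · intro w hw hroot
    rw [eval_eq_zero_iff_mem_roots F ha, h3] at hroot
    simp only [Multiset.insert_eq_cons, Multiset.mem_cons, Multiset.mem_singleton] at hroot
    rcases hroot with h | h | h
    · exfalso; rw [h, Complex.ofReal_im] at hw; exact lt_irrefl 0 hw
    · exact h
    · exfalso; rw [h, Complex.conj_im] at hw; linarith

/-! ### Root covariance and reduction -/

/-- Substitution over `ℂ`: `(f ∘ γ)(w, 1) = f(γ₀₀ w + γ₁₀, γ₀₁ w + γ₁₁)` for a real matrix `γ`. [folklore] -/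
theorem eval_map_subst (F : BinaryCubic ℝ) (γ : Matrix (Fin 2) (Fin 2) ℝ) (w : ℂ) :
    ((F.subst γ).map ofRealHom).eval w 1 =
      (F.map ofRealHom).eval ((γ 0 0 : ℂ) * w + γ 1 0) ((γ 0 1 : ℂ) * w + γ 1 1) := by
  rw [map_subst, eval_subst]
  congr 1 <;> simp [Matrix.map_apply] <;> ring

/-- **Mathews reduction (Davenport 1951 II).** Every irreducible integral binary cubic form of negative
discriminant is `GL₂(ℤ)`-equivalent to a REDUCED one: a form `g = (a, b, c, d)` admitting a real root `θ`
and a complex root `β = u + iv ∈ 𝒟` (`|u| ≤ ½`, `u² + v² ≥ 1`, `v > 0`), so that `b = −a(θ + 2u)`,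
`c = a(2θu + u² + v²)`, `d = −aθ(u² + v²)`.  Move `β(f) ∈ ℍ` into `𝒟` by `g₀ ∈ SL₂(ℤ)`
(`ModularGroup.exists_smul_mem_fd`) and use the covariance `β(f ∘ γ) = (γᵀ)⁻¹ • β(f)`.
[cite: Davenport1951CubicFormsII, §2] -/
theorem exists_gl2zEquiv_negReduced (f : BinaryCubic ℤ) (hirr : f.IsIrreducible) (h : f.disc < 0) :
    ∃ g : BinaryCubic ℤ, GL2ZEquiv f g ∧ ∃ θ u v : ℝ, 0 < v ∧ |u| ≤ 1 / 2 ∧ 1 ≤ u ^ 2 + v ^ 2 ∧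
      (g.b : ℝ) = -g.a * (θ + 2 * u) ∧ (g.c : ℝ) = g.a * (2 * θ * u + (u ^ 2 + v ^ 2)) ∧
      (g.d : ℝ) = -g.a * (θ * (u ^ 2 + v ^ 2)) := by
  classical
  set fR : BinaryCubic ℝ := f.map (Int.castRingHom ℝ) with hfR
  have hfa : fR.a ≠ 0 := by
    rw [hfR, map_a, eq_intCast]; exact_mod_cast hirr.1
  have hfD : fR.disc < 0 := by rw [hfR, disc_map, eq_intCast]; exact_mod_cast h
  obtain ⟨θ₀, β₀, hβ₀, -, -, -, hroot₀, huniq₀⟩ := exists_complexRoot fR hfa hfD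
  set z : ℍ := ⟨β₀, hβ₀⟩ with hz
  obtain ⟨g₀, hg₀⟩ := ModularGroup.exists_smul_mem_fd z
  set γ : Matrix (Fin 2) (Fin 2) ℤ := ((g₀⁻¹ : SL(2, ℤ)) : Matrix (Fin 2) (Fin 2) ℤ).transpose with hγ
  have hγdet : γ.det = 1 := by
    rw [hγ, Matrix.det_transpose]; exact (g₀⁻¹).det_coe
  set g : BinaryCubic ℤ := f.subst γ with hgdef
  have hequiv : GL2ZEquiv f g :=
    ⟨γ, by rw [hγdet]; exact isUnit_one, by rw [twist, hγdet, one_smul]⟩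
  have hgirr : g.IsIrreducible := hequiv.isIrreducible_iff.mp hirr
  -- the real picture
  set γR : Matrix (Fin 2) (Fin 2) ℝ := γ.map (Int.castRingHom ℝ) with hγR
  have hγRdet : γR.det = 1 := by
    have : γR = (Int.castRingHom ℝ).mapMatrix γ := rfl
    rw [this, ← RingHom.map_det, hγdet, map_one]
  have hγRne : γR.det ≠ 0 := by rw [hγRdet]; exact one_ne_zero
  set gR : BinaryCubic ℝ := g.map (Int.castRingHom ℝ) with hgRdef
  have hgR : gR = fR.subst γR := by rw [hgRdef, hgdef, map_subst]
  have hga : gR.a ≠ 0 := by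
    rw [hgRdef, map_a, eq_intCast]; exact_mod_cast hgirr.1
  have hgD : gR.disc < 0 := by
    rw [hgRdef, disc_map, eq_intCast]; exact_mod_cast (hequiv.disc_eq ▸ h : g.disc < 0)
  obtain ⟨θ, β, hβ, hb, hc, hd, hroot, -⟩ := exists_complexRoot gR hga hgD
  -- covariance: `G • β(g) = β(f)` with `G = γᵀ = g₀⁻¹`
  set w : ℍ := ⟨β, hβ⟩ with hw
  set G : GL (Fin 2) ℝ := Matrix.GeneralLinearGroup.mkOfDetNeZero γR.transpose
    (by rwa [Matrix.det_transpose]) with hG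
  have hGdet : 0 < G.det.val := by
    rw [Matrix.GeneralLinearGroup.val_det_apply]
    change 0 < γR.transpose.det
    rw [Matrix.det_transpose, hγRdet]; exact one_pos
  have hg00 : (G : Matrix (Fin 2) (Fin 2) ℝ) 0 0 = γR 0 0 := rfl
  have hg01 : (G : Matrix (Fin 2) (Fin 2) ℝ) 0 1 = γR 1 0 := rfl
  have hg10 : (G : Matrix (Fin 2) (Fin 2) ℝ) 1 0 = γR 0 1 := rfl
  have hg11 : (G : Matrix (Fin 2) (Fin 2) ℝ) 1 1 = γR 1 1 := rfl
  have hGw : ((G • w : ℍ) : ℂ) = ((γR 0 0 : ℂ) * β + γR 1 0) / ((γR 0 1 : ℂ) * β + γR 1 1) := by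
    rw [UpperHalfPlane.coe_smul_of_det_pos hGdet, UpperHalfPlane.num, UpperHalfPlane.denom,
      hg00, hg01, hg10, hg11]
  have hden : (γR 0 1 : ℂ) * β + γR 1 1 ≠ 0 := by
    have := UpperHalfPlane.denom_ne_zero G w
    rwa [UpperHalfPlane.denom, hg10, hg11] at this
  have hGwroot : (fR.map ofRealHom).eval ((G • w : ℍ) : ℂ) 1 = 0 := by
    have h0 : (fR.map ofRealHom).eval ((γR 0 0 : ℂ) * β + γR 1 0) ((γR 0 1 : ℂ) * β + γR 1 1) = 0 := by
      rw [← eval_map_subst, ← hgR]; exact hroot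
    rw [hGw]
    set num : ℂ := (γR 0 0 : ℂ) * β + γR 1 0
    set den : ℂ := (γR 0 1 : ℂ) * β + γR 1 1
    have h1 : (fR.map ofRealHom).eval num den =
        den ^ 3 * (fR.map ofRealHom).eval (num / den) 1 := by
      rw [← eval_mul_mul]; congr 1 <;> field_simp
    rw [h1] at h0
    exact (mul_eq_zero.mp h0).resolve_left (pow_ne_zero 3 hden)
  have hGwz : G • w = z := by
    apply UpperHalfPlane.ext
    rw [hz]
    exact huniq₀ _ (G • w).im_pos hGwroot
  have hprod : Matrix.SpecialLinearGroup.mapGL ℝ g₀ * G = 1 := by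
    apply Units.ext
    change (Matrix.SpecialLinearGroup.mapGL ℝ g₀ : Matrix (Fin 2) (Fin 2) ℝ) * γR.transpose = 1
    rw [Matrix.SpecialLinearGroup.mapGL_coe_matrix, Matrix.SpecialLinearGroup.map_apply_coe,
      RingHom.mapMatrix_apply, hγR, hγ, Matrix.transpose_map, Matrix.transpose_transpose]
    have : ((g₀⁻¹ : SL(2, ℤ)) : Matrix (Fin 2) (Fin 2) ℤ).map (Int.castRingHom ℝ) =
        ((g₀⁻¹ : SL(2, ℤ)) : Matrix (Fin 2) (Fin 2) ℤ).map (algebraMap ℤ ℝ) := rfl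
    rw [this, ← Matrix.map_mul, ← Matrix.SpecialLinearGroup.coe_mul, mul_inv_cancel,
      Matrix.SpecialLinearGroup.coe_one, Matrix.map_one _ (map_zero _) (map_one _)]
  have hwz : w = g₀ • z := by
    have h1 : Matrix.SpecialLinearGroup.mapGL ℝ g₀ • (G • w) = g₀ • z := by
      rw [hGwz]; rfl
    rw [← mul_smul, hprod, one_smul] at h1
    exact h1
  -- membership in the fundamental domain
  have hfd : w ∈ ModularGroup.fd := hwz ▸ hg₀
  obtain ⟨hnorm, hre⟩ := hfd
  change 1 ≤ Complex.normSq β at hnorm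
  change |β.re| ≤ 1 / 2 at hre
  -- back to integers
  have hb' : (g.b : ℝ) = gR.b := by rw [hgRdef, map_b, eq_intCast]
  have hc' : (g.c : ℝ) = gR.c := by rw [hgRdef, map_c, eq_intCast]
  have hd' : (g.d : ℝ) = gR.d := by rw [hgRdef, map_d, eq_intCast]
  have ha'' : gR.a = (g.a : ℝ) := by rw [hgRdef, map_a, eq_intCast]
  refine ⟨g, hequiv, θ, β.re, β.im, hβ, hre, ?_, ?_, ?_, ?_⟩
  · rw [Complex.normSq_apply] at hnorm; nlinarith [hnorm]
  · rw [hb', hb, ha'']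
  · rw [hc', hc, ha'', Complex.normSq_apply]; ring
  · rw [hd', hd, ha'', Complex.normSq_apply]; ring_nf

end BinaryCubic

end Literature.NumberTheory.CubicFields

end
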